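import Mathlib
import HarnessLib
import Summits.HubbardSuperconductivity.HubbardSuperconductivity.Theorems.KLProgrammeMatsubaraSliceBubbleTransfer
import Summits.HubbardSuperconductivity.HubbardSuperconductivity.Theorems.KLProgrammeKLRegimeSplitThermalLayerExtQuasi

/-!
# Route `KLProgramme` — ENGINE stmt-HubbardSuperconductivity-20437 `KLRegimeEngineV17F2`, row (c) value lane: the same-slice bubble AT TRANSFER with a QUASI-LIPSCHITZ
# insertion (brick 3′-3 of cure (A″) of located «(c)-OUT-COOPER-ANTIPODE», route 3′; cell gate-hubbard-kl, seat hubbard-kl-k3c2-p2 g25)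

WHY.  Sequel of `…ThermalLayerExtQuasi` (brick 3′-2): `klsp_slice_bubble_transfer_norm_le` (…SliceBubbleTransfer §2) with the insertion hypothesis weakened to
`‖W(e) − W(0)‖ ≤ L_W|e| + δ_W` on `|e| < 4Λₙ`; the zero-transfer part goes through `klte_slice_bubble_weighted_norm_le_quasi`, the transfer perturbation
(`klsp_slice_bubble_shift_norm_le`, sup `B_W` only) is unchanged.  Conclusion = the landed one + the scale-free defect `(131072/π)(ℓ_F + 8M_F)·δ_W`.
* **`klsp_slice_bubble_transfer_norm_le_quasi`**.
Next on route 3′: the window clamp (`klsw_…_quasi`), then the klsw call inside `klfb_ray_bubble_norm_le_tube` (…ForwardBubbleRayTube) is swapped for it.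
Pure analysis (the landed proof with one call swapped); nothing about the model is asserted.  0 kit · 0 lit.
-/

noncomputable section

namespace Summit.HubbardSuperconductivity.HubbardSuperconductivity.Theorems.KLRegimeSplit

set_option linter.dupNamespace false -- summit = problem name (single-conjunct summit), D-0017

open Real Finset MeasureTheory Complex Literature.MathematicalPhysics.QuantumLattice Literature.Probability.LatticeModels
open Summit.HubbardSuperconductivity.HubbardSuperconductivity.Theorems.KLProgrammeLegKernels

section ScaleForm

variable {f f' : ℝ → ℂ} {Mf Lf' Mf' ℓ' : ℝ} {W : ℝ → ℂ} {δ : ℝ → ℝ} {BW δmax : ℝ}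

/-- **The same-slice particle–hole bubble AT TRANSFER `(q₀, δ)`, in scale form, QUASI-LIPSCHITZ insertion** — `klsp_slice_bubble_transfer_norm_le` with
`‖W(e) − W(0)‖ ≤ L_W|e| + δ_W`:
`≤ (524288/π)(ℓ_F + 8M_F)·L_W·Λₙ + (131072/π)(ℓ_F + 8M_F)·δ_W + (393216/π)(ℓ_F + 8M_F)·B_W·(π/β)/Λₙ + (1024/π)·M_f·(48ℓ' + 193M_f')·B_W·(|q₀| + δ_max)/Λₙ`. -/
theorem klsp_slice_bubble_transfer_norm_le_quasi {Lf LF MF ℓF LW δW : ℝ}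
    (hlip : ∀ s s', ‖f s - f s'‖ ≤ Lf * |s - s'|) (hbd : ∀ s, ‖f s‖ ≤ Mf) {n : ℕ}
    (hin : ∀ s, s ≤ (klScale klE0 n / 2) ^ 2 → f s = 0) (hout : ∀ s, (4 * klScale klE0 n) ^ 2 ≤ s → f s = 0)
    (hlip' : ∀ s s', ‖f' s - f' s'‖ ≤ Lf' * |s - s'|) (hbd' : ∀ s, ‖f' s‖ ≤ Mf') (hLf' : Lf' ≤ ℓ' / klScale klE0 n ^ 2)
    (hin' : ∀ s, s ≤ (klScale klE0 n / 2) ^ 2 → f' s = 0) (hout' : ∀ s, (4 * klScale klE0 n) ^ 2 ≤ s → f' s = 0)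
    (hMF : 0 ≤ MF) (hFlip : ∀ s s', ‖f s * f' s - f s' * f' s'‖ ≤ LF * |s - s'|) (hFbd : ∀ s, ‖f s * f' s‖ ≤ MF)
    (hLF : LF ≤ ℓF / klScale klE0 n ^ 2)
    (hW : Continuous W) (hLW : 0 ≤ LW) (hδW : 0 ≤ δW) (hBW : 0 ≤ BW)
    (hWlip : ∀ e : ℝ, |e| < 4 * klScale klE0 n → ‖W e - W 0‖ ≤ LW * |e| + δW)
    (hWbd : ∀ e, |e| < 4 * klScale klE0 n → ‖W e‖ ≤ BW)
    (hδc : Continuous δ) (hδ0 : 0 ≤ δmax) (hδ : ∀ e, |δ e| ≤ δmax)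
    (q₀ : ℝ) {β : ℝ} (hβ : klBetaMin ≤ β) (hn : n ≤ nScales β + 1) {M : ℕ}
    (hM : β * (4 * klScale klE0 n) / (2 * Real.pi) + 1 ≤ M) :
    ‖β⁻¹ • ∑ i : MatsubaraIdx M, ∫ e,
        W e * (f (matsubaraFreq β M i ^ 2 + e ^ 2) / (((matsubaraFreq β M i ^ 2 + e ^ 2 : ℝ)) : ℂ) * (I * (matsubaraFreq β M i) + e)) *
          (f' ((matsubaraFreq β M i + q₀) ^ 2 + (e + δ e) ^ 2) / ((((matsubaraFreq β M i + q₀) ^ 2 + (e + δ e) ^ 2 : ℝ)) : ℂ) *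
              (I * ((matsubaraFreq β M i + q₀ : ℝ) : ℂ) + ((e + δ e : ℝ) : ℂ)))‖ ≤
      524288 / Real.pi * (ℓF + 8 * MF) * LW * klScale klE0 n + 131072 / Real.pi * (ℓF + 8 * MF) * δW +
        393216 / Real.pi * (ℓF + 8 * MF) * BW * ((Real.pi / β) / klScale klE0 n) +
          1024 / Real.pi * Mf * (48 * ℓ' + 193 * Mf') * BW * (|q₀| + δmax) / klScale klE0 n := by
  set Λ := klScale klE0 n with hΛdef
  have hΛ : 0 < Λ := klth_klScale_pos n
  have hβ0 : 0 < β := pos_of_klBetaMin_le hβ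
  have hr₁ : 0 < Λ / 2 := by positivity
  have hr : 0 < 4 * Λ := by positivity
  set ω : MatsubaraIdx M → ℝ := fun i => matsubaraFreq β M i with hω
  -- names for the three integrand families
  set Φ : ℝ → ℝ → ℂ := fun k₀ e => f (k₀ ^ 2 + e ^ 2) / (((k₀ ^ 2 + e ^ 2 : ℝ)) : ℂ) * (I * k₀ + e) with hΦ
  set Ψ : ℝ → ℝ → ℂ := fun k₀ e => f' (k₀ ^ 2 + e ^ 2) / (((k₀ ^ 2 + e ^ 2 : ℝ)) : ℂ) * (I * k₀ + e) with hΨ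
  -- the singularity-free weights and their properties
  have hgsupp : ∀ s, (4 * Λ) ^ 2 ≤ s → (fun s : ℝ => f s / ((s : ℝ) : ℂ)) s = 0 := fun s hs => by
    simp only [hout s hs, zero_div]
  have hglip : ∀ s s', ‖(fun s : ℝ => f s / ((s : ℝ) : ℂ)) s - (fun s : ℝ => f s / ((s : ℝ) : ℂ)) s'‖ ≤
      (Lf / (Λ / 2) ^ 2 + Mf / (Λ / 2) ^ 4) * |s - s'| := fun s s' => klsp_div_lipschitz hlip hbd hin hr₁ s s'
  have hgbd : ∀ s, ‖(fun s : ℝ => f s / ((s : ℝ) : ℂ)) s‖ ≤ Mf / (Λ / 2) ^ 2 := fun s => klsp_div_norm_le hbd hin hr₁ s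
  have hg'supp : ∀ s, (4 * Λ) ^ 2 ≤ s → (fun s : ℝ => f' s / ((s : ℝ) : ℂ)) s = 0 := fun s hs => by
    simp only [hout' s hs, zero_div]
  have hg'lip : ∀ s s', ‖(fun s : ℝ => f' s / ((s : ℝ) : ℂ)) s - (fun s : ℝ => f' s / ((s : ℝ) : ℂ)) s'‖ ≤
      (Lf' / (Λ / 2) ^ 2 + Mf' / (Λ / 2) ^ 4) * |s - s'| := fun s s' => klsp_div_lipschitz hlip' hbd' hin' hr₁ s s'
  have hg'bd : ∀ s, ‖(fun s : ℝ => f' s / ((s : ℝ) : ℂ)) s‖ ≤ Mf' / (Λ / 2) ^ 2 := fun s => klsp_div_norm_le hbd' hin' hr₁ s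
  -- continuity in `e` of the factors
  have hΦc : ∀ k₀, Continuous fun e => Φ k₀ e := fun k₀ => klsp_continuous_snd hglip hgbd hgsupp hr k₀
  have hΨc : ∀ k₀, Continuous fun e => Ψ k₀ e := fun k₀ => klsp_continuous_snd hg'lip hg'bd hg'supp hr k₀
  have hΨsc : ∀ k₀, Continuous fun e => Ψ (k₀ + q₀) (e + δ e) := fun k₀ =>
    (hΨc (k₀ + q₀)).comp (continuous_id.add hδc)
  have hΦzero : ∀ k₀ e, 4 * Λ ≤ |e| → Φ k₀ e = 0 := fun k₀ e he => klsp_zero_of_le_abs_snd hgsupp hr.le k₀ he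
  -- integrability of the two pieces of each slice (continuous, supported in `[-4Λ, 4Λ]`)
  have hint1 : ∀ k₀ : ℝ, Integrable fun e : ℝ => W e * Φ k₀ e * Ψ k₀ e := by
    intro k₀
    have hcont : Continuous fun e : ℝ => W e * Φ k₀ e * Ψ k₀ e := (hW.mul (hΦc k₀)).mul (hΨc k₀)
    refine hcont.integrable_of_hasCompactSupport ?_
    refine HasCompactSupport.intro (isCompact_Icc (a := -(4 * Λ)) (b := 4 * Λ)) fun e he => ?_
    rw [hΦzero k₀ e (klsp_le_abs_of_not_mem_Icc he), mul_zero, zero_mul]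
  have hint2 : ∀ k₀ : ℝ, Integrable fun e : ℝ => W e * Φ k₀ e * (Ψ (k₀ + q₀) (e + δ e) - Ψ k₀ e) := by
    intro k₀
    have hcont : Continuous fun e : ℝ => W e * Φ k₀ e * (Ψ (k₀ + q₀) (e + δ e) - Ψ k₀ e) :=
      (hW.mul (hΦc k₀)).mul ((hΨsc k₀).sub (hΨc k₀))
    refine hcont.integrable_of_hasCompactSupport ?_
    refine HasCompactSupport.intro (isCompact_Icc (a := -(4 * Λ)) (b := 4 * Λ)) fun e he => ?_
    rw [hΦzero k₀ e (klsp_le_abs_of_not_mem_Icc he), mul_zero, zero_mul]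
  -- split each slice: `Ψ_shift = Ψ + (Ψ_shift − Ψ)`
  have hsplit : ∀ i : MatsubaraIdx M,
      (∫ e, W e * Φ (ω i) e * Ψ (ω i + q₀) (e + δ e)) =
        (∫ e, W e * Φ (ω i) e * Ψ (ω i) e) + ∫ e, W e * Φ (ω i) e * (Ψ (ω i + q₀) (e + δ e) - Ψ (ω i) e) := by
    intro i
    rw [← integral_add (hint1 (ω i)) (hint2 (ω i))]
    refine integral_congr_ae (Filter.Eventually.of_forall fun e => ?_)
    simp only
    ring
  -- the zero-transfer integrand in the carrier's form `F(s)((−ik₀+e)²)⁻¹ W(e)`, `F = f f'`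
  have hzero_form : ∀ (k₀ e : ℝ), W e * Φ k₀ e * Ψ k₀ e =
      (f (k₀ ^ 2 + e ^ 2) * f' (k₀ ^ 2 + e ^ 2)) * ((-I * k₀ + e) ^ 2)⁻¹ * W e := by
    intro k₀ e
    simp only [hΦ, hΨ]
    rw [klsp_div_propagator_eq f k₀ e, klsp_div_propagator_eq f' k₀ e]
    rw [show ((-I * (k₀ : ℂ) + e) ^ 2)⁻¹ = (-I * k₀ + e)⁻¹ * (-I * k₀ + e)⁻¹ by rw [sq, mul_inv]]
    ring
  -- assemble
  have hsum : (β⁻¹ • ∑ i : MatsubaraIdx M, ∫ e, W e * Φ (ω i) e * Ψ (ω i + q₀) (e + δ e)) =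
      β⁻¹ • (∑ i : MatsubaraIdx M, ∫ e, (f (ω i ^ 2 + e ^ 2) * f' (ω i ^ 2 + e ^ 2)) * ((-I * (ω i) + e) ^ 2)⁻¹ * W e) +
        β⁻¹ • ∑ i : MatsubaraIdx M, ∫ e, W e * Φ (ω i) e * (Ψ (ω i + q₀) (e + δ e) - Ψ (ω i) e) := by
    rw [← smul_add, ← Finset.sum_add_distrib]
    congr 1
    refine Finset.sum_congr rfl fun i _ => ?_
    rw [hsplit i]
    congr 1
    refine integral_congr_ae (Filter.Eventually.of_forall fun e => ?_)
    exact hzero_form (ω i) e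
  have h1 := klte_slice_bubble_weighted_norm_le_quasi (F := fun s => f s * f' s) (W := W) hMF hFlip hFbd hLF
    (fun s hs => by simp only [hin s hs, zero_mul]) (fun s hs => by simp only [hout s hs, zero_mul])
    hW hLW hδW hBW hWlip hWbd hβ hn hM
  have h2 := klsp_slice_bubble_shift_norm_le hbd hin hout hlip' hbd' hLf' hin' hout' hBW hWbd hδ0 hδ q₀ hβ hn M
  change ‖β⁻¹ • ∑ i : MatsubaraIdx M, ∫ e, W e * Φ (ω i) e * Ψ (ω i + q₀) (e + δ e)‖ ≤ _
  rw [hsum]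
  refine (norm_add_le _ _).trans ?_
  exact add_le_add h1 h2

end ScaleForm

end Summit.HubbardSuperconductivity.HubbardSuperconductivity.Theorems.KLRegimeSplit

end
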